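import Literature.NumberTheory.Automorphic.CongruenceSubgroupPropertySL2Proofs
import Mathlib.LinearAlgebra.Matrix.SpecialLinearGroup
import Mathlib.RingTheory.Localization.Away.Basic
import Mathlib.RingTheory.Localization.Ideal
import Mathlib.Data.ZMod.QuotientRing
import HarnessLib

/-!
# Bounded generation by elementary matrices in finite-index subgroups of `SL(n, ℤ_S)`
# (Carter–Keller–Paige; Morris 2007, Thm. 6.1 (2)) — the named fact and its `SL₂(ℤ[1/m])` consumer form

Topic `Literature/GroupTheory/ArithmeticGroups`; namespace `Literature.GroupTheory.ArithmeticGroups`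
(grouping sub-namespace `Morris2007` for the fact).  STATEMENT-ONLY named fact (D-0014/D-0064) with
real DEFINITIONS of the two printed notions it uses and PROVED consumer corollaries; no `sorry`.

**Source, read at the page.** D. W. Morris, *Bounded generation of `SL(n, A)` (after D. Carter,
G. Keller, and E. Paige)*, New York J. Math. 13 (2007) 383–421 = arXiv:math/0503083 (held, store
`paper:arxiv-math_0503083`; the arXiv text has a running counter: journal Thm. 6.1 = arXiv
"Theorem 81", journal Def. 1.1 = arXiv "Definition 1", §2.1 Notation = arXiv "Notation 12").
A refereed exposition with full proofs of the unpublished preprint of Carter, Keller and Paige [CKP]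
("they should be given full credit for the results", arXiv p. 3); the proofs go through the Compactness
Theorem of first-order logic and give no explicit bound.

* Def. 1.1 [arXiv p0003:L16–L22]: "A subset `X` of a group `G` *boundedly generates* `G` if there is a
  positive integer `r`, such that every element of `G` can be written as a word of length `≤ r` in
  `X ∪ X⁻¹`. That is, for each `g ∈ G`, there is a sequence `x₁, x₂, …, x_ℓ` of elements of `X ∪ X⁻¹`,
  with `ℓ ≤ r`, such that `g = x₁ x₂ ⋯ x_ℓ`."  — `BoundedlyGenerates X H` below (for a subgroup `H`
  of an ambient group, with `X ⊆ H`).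
* §2.1 [arXiv p0005]: Def. 10 "`B` an integral domain; a subset `S` of `B` is *multiplicative* if `S`
  is closed under multiplication and `0 ∉ S`; `B_S = {b/s : b ∈ B, s ∈ S}`"; Notation 12: for a
  commutative ring `A`, an ideal `𝔮` and `i ≠ j`, "`E_{i,j}(a)` the elementary matrix … `LU(n, 𝔮) =
  {E_{i,j}(a) : a ∈ 𝔮, i ≠ j}` … `LU(n, A)` is the set of all `n × n` elementary matrices, and
  `LU(n, 𝔮) = LU(n, A) ∩ SL(n, A; 𝔮)`", `SL(n, A; 𝔮) = {T ∈ SL(n, A) : T ≡ 1 mod 𝔮}`.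
  — `elementarySet n A` below (Mathlib's `Matrix.SpecialLinearGroup.transvection`).
* **Thm. 6.1** [arXiv p0019:L3–L26] "(cf. [CKP]). Let `n` be a positive integer, `K` be an algebraic
  number field, `k` be the degree of `K` over `ℚ`, `B` be an order in `K`, and `S` be a multiplicative
  subset of `B`. Assume that either `n ≥ 3` or `B_S` has infinitely many units. (1) If `X◁` is any subset
  of `SL(n, B_S)`, such that `g⁻¹ X◁ g = X◁`, for every `g ∈ E(n, B_S)` (and `X◁` does not consist
  entirely of scalar matrices), then `X◁` boundedly generates a finite-index subgroup of `SL(n, B_S)`.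
  **(2)** For any finite-index subgroup `Γ` of `SL(n, B_S)`, the set `LU(n, B_S) ∩ Γ` of elementary
  matrices in `Γ` boundedly generates a subgroup of finite index in `Γ`."  (Proof of (2), arXiv p0020:
  `⟨LU(n, 𝔮)⟩ ⊇ E◁(n, B_S; 𝔮′)`, which has finite index in `SL(n, B_S)` by [BMS]/[Serre 1970]/[Vaserstein
  1972], and `⟨LU(n,𝔮)⟩ = ⟨LU(n,𝔮)⟩_{r′}`; Remark 1.3: for `n = 2` the unit hypothesis is necessary.)

**Instance vendored** (the tree speaks `ℤ` and Mathlib localisations; the paper's `K`, `B` are more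
general): `K = ℚ`, `B = ℤ`, `S ⊆ ℤ` any multiplicative subset (a submonoid not containing `0`),
`B_S = Localization S`, every `n ≥ 1`, part **(2)**, with the hypothesis "`n ≥ 3` or `B_S` has
infinitely many units" DISPLAYED — `Morris2007.thm61_2_elementary_boundedlyGenerates`.  Part (1) is
not transcribed (no consumer).
-- TODO(general form): `K` any number field, `B` any order in `K`, `S ⊆ B` multiplicative, `B_S`.

**Proved here (no further facts).**  `BoundedlyGenerates.closure_eq`; at `n = 2` the dictionary with
the tree's `SL₂` vocabulary of `Literature/NumberTheory/Automorphic/CongruenceSubgroupPropertySL2Proofs.lean`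
(`transvection_eq_e12`, `transvection_eq_e21`, `mem_elementarySet_two_iff`,
`elementarySet_inter_Gamma_subset`: `LU(2, A) ∩ Γ(𝔮) ⊆ E₁₂(𝔮) ∪ E₂₁(𝔮)`, i.e. `LU(2,𝔮) = LU(2,A) ∩
SL(2,A;𝔮)`); for `A = ℤ[1/m]` (`Localization.Away (m : ℤ)`, `m ≥ 2`): `zero_not_mem_powers`,
`infinite_units_away` (the DISCHARGE of the displayed unit hypothesis: `m` is a unit of infinite order),
`finite_quotient_map_of_isLocalization` + `finite_quotient_away_span_natCast` (`ℤ[1/m]/(N)` is finite,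
`N ≥ 1`), `Gamma_finiteIndex_of_finite_quotient` (`Γ(𝔮)` has finite index when `A/𝔮` is finite —
Serre 1970 §1.2), and the CONSUMER FORM used by cell bsd-f3-mu's THEOREM B (MEMO-an §13.2 (ii)–(iii)
with `Γ = SL₂(A; NA)`, Sketch4 `ElementaryLevelSubgroupFiniteIndex p N`):
`Morris2007.relE_span_natCast_finiteIndex` — the elementary subgroup of level `N`,
`E(N A, N A) = ⟨E₁₂(N t), E₂₁(N t) : t ∈ ℤ[1/m]⟩ = SL2Rel.relE (N) (N)`, has finite index in
`SL₂(ℤ[1/m])` — and its `Set.range` spelling `Morris2007.closure_range_e12_e21_finiteIndex`.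

References: [Morris2007] D. W. Morris, New York J. Math. 13 (2007) 383–421 (arXiv:math/0503083),
Def. 1.1, §2.1, Rem. 1.3, Thm. 6.1; [SerreSL2Congruence1970] J.-P. Serre, Ann. of Math. 92 (1970),
§1.2 (`A/𝔮` finite, `Γ_𝔮` of finite index); [Vaserstein1972SL2] (the finite-index input of the
printed proof, `n = 2`).
-/

open Matrix MatrixGroups

namespace Literature.GroupTheory.ArithmeticGroups

/-! ### Morris's Definition 1.1: bounded generation -/

/-- **Bounded generation** (Morris 2007, Def. 1.1: "A subset `X` of a group `G` boundedly generates `G`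
if there is a positive integer `r`, such that every element of `G` can be written as a word of length
`≤ r` in `X ∪ X⁻¹`"), for a subset `X` of a subgroup `H` of an ambient group: `X ⊆ H` and there is `r`
such that every `g ∈ H` is a product of a list of length `≤ r` of elements of `X ∪ X⁻¹`.  (Then `H` is
the subgroup generated by `X`: `BoundedlyGenerates.closure_eq`.) [cite: Morris2007, §1 Def. 1.1] -/
def BoundedlyGenerates {G : Type*} [Group G] (X : Set G) (H : Subgroup G) : Prop :=
  X ⊆ H ∧ ∃ r : ℕ, ∀ g ∈ H, ∃ l : List G, l.length ≤ r ∧ (∀ x ∈ l, x ∈ X ∨ x⁻¹ ∈ X) ∧ l.prod = g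

namespace BoundedlyGenerates

variable {G : Type*} [Group G] {X : Set G} {H : Subgroup G}

/-- A boundedly generating subset lies in the subgroup. [cite: Morris2007, §1 Def. 1.1] -/
theorem subset (h : BoundedlyGenerates X H) : X ⊆ H := h.1

/-- A boundedly generating subset GENERATES the subgroup. [cite: Morris2007, §1 Def. 1.1] -/
theorem closure_eq (h : BoundedlyGenerates X H) : Subgroup.closure X = H := by
  refine le_antisymm ((Subgroup.closure_le _).2 h.1) fun g hg ↦ ?_
  obtain ⟨r, hr⟩ := h.2
  obtain ⟨l, -, hl, rfl⟩ := hr g hg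
  refine Subgroup.list_prod_mem _ fun x hx ↦ ?_
  rcases hl x hx with hxX | hxX
  · exact Subgroup.subset_closure hxX
  · rw [← inv_inv x]
    exact (Subgroup.closure X).inv_mem (Subgroup.subset_closure hxX)

end BoundedlyGenerates

/-! ### Morris's `LU(n, A)`: the elementary matrices of `SL(n, A)` -/

/-- **The set `LU(n, A)` of elementary matrices** `E_{i,j}(a) = 1 + a e_{ij}` (`i ≠ j`, `a ∈ A`) of
`SL(n, A)` (Morris 2007, §2.1: "`LU(n, A)` is the set of all `n × n` elementary matrices"), as
Mathlib's `Matrix.SpecialLinearGroup.transvection`. [cite: Morris2007, §2.1 (Notation: `LU(n, 𝔮)`)] -/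
def elementarySet (n : ℕ) (A : Type*) [CommRing A] : Set SL(n, A) :=
  {g | ∃ (i j : Fin n) (h : i ≠ j) (a : A), g = Matrix.SpecialLinearGroup.transvection h a}

/-! ### The named fact: Morris 2007, Thm. 6.1 (2), at `K = ℚ`, `B = ℤ` -/

namespace Morris2007

/-- **Carter–Keller–Paige / Morris 2007, Thm. 6.1 (2), for `B = ℤ`** (D. W. Morris, *Bounded generation
of `SL(n,A)`*, New York J. Math. 13 (2007) 383–421, Thm. 6.1 = arXiv:math/0503083 Theorem 81: "Let `n`
be a positive integer, `K` be an algebraic number field, `k` be the degree of `K` over `ℚ`, `B` be an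
order in `K`, and `S` be a multiplicative subset of `B` [§2.1: closed under multiplication, `0 ∉ S`;
`B_S = {b/s}`]. Assume that either `n ≥ 3` or `B_S` has infinitely many units. … (2) For any
finite-index subgroup `Γ` of `SL(n, B_S)`, the set `LU(n, B_S) ∩ Γ` of elementary matrices in `Γ`
boundedly generates a subgroup of finite index in `Γ`"), at the instance `K = ℚ` (`k = 1`), `B = ℤ`
(the maximal order), `S ⊆ ℤ` any submonoid with `0 ∉ S`, `B_S = Localization S` (e.g. `S = {mᵏ}`,
`B_S = ℤ[1/m]`), every `n ≥ 1`, with the printed hypothesis "`n ≥ 3` or `B_S` has infinitely many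
units" displayed (`Infinite (Localization S)ˣ`; for `n = 2` it is necessary, Rem. 1.3): for every
subgroup `Γ ≤ SL(n, ℤ_S)` of finite index there is a subgroup `H ≤ Γ` of finite index in `Γ` which
the elementary matrices lying in `Γ`, `LU(n, ℤ_S) ∩ Γ`, boundedly generate (Def. 1.1).  Part (1)
(normal subsets) is not transcribed.
-- TODO(general form): `K` any number field, `B` any order in `K`, `S ⊆ B` multiplicative, `SL(n, B_S)`.
[cite: Morris2007, Thm. 6.1 (2)] -/
def thm61_2_elementary_boundedlyGenerates : Prop :=
  ∀ (S : Submonoid ℤ), (0 : ℤ) ∉ S →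
    ∀ (n : ℕ), 0 < n → (3 ≤ n ∨ Infinite (Localization S)ˣ) →
      ∀ Γ : Subgroup SL(n, Localization S), Γ.FiniteIndex →
        ∃ H : Subgroup SL(n, Localization S), H ≤ Γ ∧ (H.subgroupOf Γ).FiniteIndex ∧
          BoundedlyGenerates (elementarySet n (Localization S) ∩ (Γ : Set SL(n, Localization S))) H

end Morris2007

/-! ### `n = 2`: dictionary with the tree's `SL₂` vocabulary (`SL2Rel.e12`, `SL2Rel.e21`, `SL2Rel.Gamma`,
`SL2Rel.relE` of `CongruenceSubgroupPropertySL2Proofs.lean`) -/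

section Two

open Literature.NumberTheory.Automorphic Literature.NumberTheory.Automorphic.SL2Rel

variable {R : Type*} [CommRing R]

/-- `E_{0,1}(a)` is the tree's `E₁₂(a) = (1 a; 0 1)`. [cite: Morris2007, §2.1 (Notation: `E_{i,j}(a)`)] -/
theorem transvection_eq_e12 (a : R) :
    Matrix.SpecialLinearGroup.transvection (i := (0 : Fin 2)) (j := 1) (by decide) a = e12 a := by
  refine Subtype.ext ?_
  rw [Matrix.SpecialLinearGroup.transvection_coe]
  ext i j
  fin_cases i <;> fin_cases j <;> simp [e12, Matrix.single]

/-- `E_{1,0}(a)` is the tree's `E₂₁(a) = (1 0; a 1)`. [cite: Morris2007, §2.1 (Notation: `E_{i,j}(a)`)] -/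
theorem transvection_eq_e21 (a : R) :
    Matrix.SpecialLinearGroup.transvection (i := (1 : Fin 2)) (j := 0) (by decide) a = e21 a := by
  refine Subtype.ext ?_
  rw [Matrix.SpecialLinearGroup.transvection_coe]
  ext i j
  fin_cases i <;> fin_cases j <;> simp [e21, Matrix.single]

/-- `LU(2, A) = {E₁₂(a)} ∪ {E₂₁(a)}`. [cite: Morris2007, §2.1 (Notation: `LU(n, A)`)] -/
theorem mem_elementarySet_two_iff (g : SL(2, R)) :
    g ∈ elementarySet 2 R ↔ (∃ a : R, g = e12 a) ∨ ∃ a : R, g = e21 a := by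
  constructor
  · rintro ⟨i, j, h, a, rfl⟩
    fin_cases i <;> fin_cases j
    · exact absurd rfl h
    · exact Or.inl ⟨a, transvection_eq_e12 a⟩
    · exact Or.inr ⟨a, transvection_eq_e21 a⟩
    · exact absurd rfl h
  · rintro (⟨a, rfl⟩ | ⟨a, rfl⟩)
    · exact ⟨0, 1, by decide, a, (transvection_eq_e12 a).symm⟩
    · exact ⟨1, 0, by decide, a, (transvection_eq_e21 a).symm⟩

/-- `E₁₂(a) ∈ LU(2, A)`. [cite: Morris2007, §2.1 (Notation: `LU(n, A)`)] -/
theorem e12_mem_elementarySet (a : R) : e12 a ∈ elementarySet 2 R :=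
  (mem_elementarySet_two_iff _).2 (Or.inl ⟨a, rfl⟩)

/-- `E₂₁(a) ∈ LU(2, A)`. [cite: Morris2007, §2.1 (Notation: `LU(n, A)`)] -/
theorem e21_mem_elementarySet (a : R) : e21 a ∈ elementarySet 2 R :=
  (mem_elementarySet_two_iff _).2 (Or.inr ⟨a, rfl⟩)

/-- **`LU(2, 𝔮) = LU(2, A) ∩ SL(2, A; 𝔮)`** (Morris, §2.1), the inclusion used here: an elementary matrix
lying in `Γ(𝔮)` is `E₁₂(x)` or `E₂₁(x)` with `x ∈ 𝔮`. [cite: Morris2007, §2.1 (Notation: `LU(n, 𝔮)`)] -/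
theorem elementarySet_inter_Gamma_subset (I : Ideal R) :
    elementarySet 2 R ∩ (Gamma I : Set SL(2, R)) ⊆ (e12 '' (I : Set R)) ∪ (e21 '' (I : Set R)) := by
  rintro g ⟨hg, hΓ⟩
  have hΓ' : g ∈ Gamma I := hΓ
  rw [mem_Gamma] at hΓ'
  rcases (mem_elementarySet_two_iff g).1 hg with ⟨a, rfl⟩ | ⟨a, rfl⟩
  · exact Or.inl ⟨a, by simpa using hΓ'.1, rfl⟩
  · exact Or.inr ⟨a, by simpa using hΓ'.2.1, rfl⟩

/-- Hence `⟨LU(2, A) ∩ Γ(𝔮)⟩ ≤ E(𝔮, 𝔮) = ⟨E₁₂(𝔮), E₂₁(𝔮)⟩`. [cite: Morris2007, §2.1 (`E(n, 𝔮) = ⟨LU(n, 𝔮)⟩`)] -/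
theorem closure_elementarySet_inter_Gamma_le (I : Ideal R) :
    Subgroup.closure (elementarySet 2 R ∩ (Gamma I : Set SL(2, R))) ≤ relE I I :=
  (Subgroup.closure_le _).2 fun _ hg ↦ Subgroup.subset_closure (elementarySet_inter_Gamma_subset I hg)

/-- **`Γ(𝔮)` has finite index when `A/𝔮` is finite** (Serre 1970, §1.2: "Le quotient `A/𝔮` est fini …
son noyau `Γ_𝔮` … c'est un sous-groupe d'indice fini de `Γ_A`"): the index of the kernel is the
cardinality of the image in the finite group `SL₂(A/𝔮)`. [cite: SerreSL2Congruence1970, §1.2] -/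
theorem Gamma_finiteIndex_of_finite_quotient (I : Ideal R) [Finite (R ⧸ I)] : (Gamma I).FiniteIndex := by
  haveI : Finite (Matrix (Fin 2) (Fin 2) (R ⧸ I)) := Pi.finite
  haveI : Finite SL(2, R ⧸ I) := Subtype.finite
  refine Subgroup.finiteIndex_iff.2 ?_
  rw [Gamma, Subgroup.index_ker]
  exact Nat.card_pos.ne'

end Two

/-! ### `A = ℤ[1/m]`: the displayed unit hypothesis and the finiteness of `ℤ[1/m]/(N)` -/

section Away

variable {m : ℕ}

/-- `S = {mᵏ}` is a multiplicative subset of `ℤ` in Morris's sense: `0 ∉ S` (`m ≠ 0`).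
[cite: Morris2007, §2.1 Def. (multiplicative subset)] -/
theorem zero_not_mem_powers (hm : m ≠ 0) : (0 : ℤ) ∉ Submonoid.powers (m : ℤ) := by
  rintro ⟨k, hk⟩
  exact pow_ne_zero k (by exact_mod_cast hm : (m : ℤ) ≠ 0) hk

/-- **`ℤ[1/m]` has infinitely many units for `m ≥ 2`** — the DISCHARGE of the displayed hypothesis of
Thm. 6.1 at `n = 2` (`m` is a unit of `ℤ[1/m]` of infinite order: `k ↦ mᵏ` is injective).
[cite: Morris2007, Thm. 6.1 (hypothesis "`B_S` has infinitely many units") and Rem. 1.3] -/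
theorem infinite_units_away (hm : 2 ≤ m) : Infinite (Localization.Away (m : ℤ))ˣ := by
  have hm0 : (m : ℤ) ≠ 0 := by exact_mod_cast (show m ≠ 0 by omega)
  have hinj : Function.Injective (algebraMap ℤ (Localization.Away (m : ℤ))) :=
    IsLocalization.injective (M := Submonoid.powers (m : ℤ)) _
      (powers_le_nonZeroDivisors_of_noZeroDivisors hm0)
  set u : (Localization.Away (m : ℤ))ˣ :=
    (IsLocalization.Away.algebraMap_isUnit (S := Localization.Away (m : ℤ)) (m : ℤ)).unit with hu
  refine Infinite.of_injective (fun k : ℕ ↦ u ^ k) fun i j hij ↦ ?_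
  have h1 : ((u ^ i : (Localization.Away (m : ℤ))ˣ) : Localization.Away (m : ℤ)) =
      ((u ^ j : (Localization.Away (m : ℤ))ˣ) : Localization.Away (m : ℤ)) := by
    rw [show u ^ i = u ^ j from hij]
  simp only [Units.val_pow_eq_pow_val, hu, IsUnit.unit_spec, ← map_pow] at h1
  have h2 : ((m : ℤ)) ^ i = ((m : ℤ)) ^ j := hinj h1
  exact Nat.pow_right_injective hm (by exact_mod_cast h2)

/-- A localisation of a ring with finite quotient `R/I` has finite quotient by the extended ideal:
`S/IS` is a localisation of `R/I` (Mathlib), hence a quotient of the finite set `R/I × M`.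
[cite: SerreSL2Congruence1970, §1.2 (`Le quotient A/𝔮 est fini`)] -/
theorem finite_quotient_map_of_isLocalization {R S : Type*} [CommRing R] [CommRing S] [Algebra R S]
    (M : Submonoid R) [IsLocalization M S] (I : Ideal R) [Finite (R ⧸ I)] :
    Finite (S ⧸ I.map (algebraMap R S)) := by
  haveI : Finite (Algebra.algebraMapSubmonoid (R ⧸ I) M) := Subtype.finite
  exact Finite.of_surjective _
    (IsLocalization.mk'_surjective (Algebra.algebraMapSubmonoid (R ⧸ I) M)
      (S := S ⧸ I.map (algebraMap R S)))

/-- **`ℤ[1/m]/(N)` is finite for `N ≥ 1`** (`(N) ⊆ ℤ[1/m]` is the extension of `(N) ⊆ ℤ`, and `ℤ/(N)`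
is finite). [cite: SerreSL2Congruence1970, §1.2 (`Le quotient A/𝔮 est fini`)] -/
theorem finite_quotient_away_span_natCast {N : ℕ} (hN : N ≠ 0) :
    Finite (Localization.Away (m : ℤ) ⧸ Ideal.span {(N : Localization.Away (m : ℤ))}) := by
  haveI : NeZero N := ⟨hN⟩
  haveI : Finite (ℤ ⧸ Ideal.span {(N : ℤ)}) :=
    Finite.of_equiv (ZMod N) (Int.quotientSpanNatEquivZMod N).symm.toEquiv
  have hmap : (Ideal.span {(N : ℤ)}).map (algebraMap ℤ (Localization.Away (m : ℤ))) =
      Ideal.span {(N : Localization.Away (m : ℤ))} := by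
    rw [Ideal.map_span, Set.image_singleton, map_natCast]
  haveI := finite_quotient_map_of_isLocalization (Submonoid.powers (m : ℤ))
    (S := Localization.Away (m : ℤ)) (Ideal.span {(N : ℤ)})
  exact Finite.of_equiv _ (Ideal.quotEquivOfEq hmap).toEquiv

end Away

/-! ### The consumer form: the elementary subgroup of level `N` has finite index in `SL₂(ℤ[1/m])` -/

namespace Morris2007

open Literature.NumberTheory.Automorphic Literature.NumberTheory.Automorphic.SL2Rel

/-- **Consumer form of Thm. 6.1 (2)** (the sentence cell bsd-f3-mu's THEOREM B invokes, MEMO-an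
§13.2 (ii)–(iii): "(L) with `Γ = SL₂(A; NA)` ⟹ `⟨U⁺(NA), U⁻(NA)⟩` has finite index", `A = ℤ[1/p]`):
for `m ≥ 2` and `N ≥ 1`, the subgroup `E(NA, NA) = ⟨E₁₂(x), E₂₁(x) : x ∈ N·ℤ[1/m]⟩` (the tree's
`SL2Rel.relE (N) (N)`) has finite index in `SL₂(ℤ[1/m])`.  From the fact: `Γ(NA)` has finite index
(`A/NA` finite), the unit hypothesis holds (`infinite_units_away`), so some `H ≤ Γ(NA)` of finite index
in `Γ(NA)` — hence in `SL₂(A)` — is generated by `LU(2, A) ∩ Γ(NA) ⊆ E₁₂(NA) ∪ E₂₁(NA)`, and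
`H ≤ E(NA, NA)`. [cite: Morris2007, Thm. 6.1 (2)] -/
theorem relE_span_natCast_finiteIndex (h : thm61_2_elementary_boundedlyGenerates) {m : ℕ} (hm : 2 ≤ m)
    {N : ℕ} (hN : N ≠ 0) :
    (relE (Ideal.span {(N : Localization.Away (m : ℤ))})
      (Ideal.span {(N : Localization.Away (m : ℤ))})).FiniteIndex := by
  set I : Ideal (Localization.Away (m : ℤ)) := Ideal.span {(N : Localization.Away (m : ℤ))} with hI
  haveI : Finite (Localization.Away (m : ℤ) ⧸ I) := finite_quotient_away_span_natCast hN
  have hΓ : (Gamma I).FiniteIndex := Gamma_finiteIndex_of_finite_quotient I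
  obtain ⟨H, hHle, hHfi, hbg⟩ := h (Submonoid.powers (m : ℤ)) (zero_not_mem_powers (by omega)) 2
    two_pos (Or.inr (infinite_units_away hm)) (Gamma I) hΓ
  -- `H` has finite index in `SL₂(A)`: `[SL₂ : H] = [Γ(I) : H] · [SL₂ : Γ(I)]`
  haveI : H.FiniteIndex := by
    refine Subgroup.finiteIndex_iff.2 ?_
    rw [← Subgroup.relIndex_mul_index hHle]
    exact mul_ne_zero (Subgroup.finiteIndex_iff.1 hHfi) (Subgroup.finiteIndex_iff.1 hΓ)
  -- and `H = ⟨LU(2, A) ∩ Γ(I)⟩ ≤ E(I, I)`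
  have hHE : H ≤ relE I I := by
    rw [← hbg.closure_eq]
    exact closure_elementarySet_inter_Gamma_le I
  exact Subgroup.finiteIndex_of_le hHE

/-- `E₁₂((N)) = {E₁₂(N t)}` as a range. [cite: Morris2007, §2.1 (Notation: `LU(n, 𝔮)`)] -/
theorem image_e12_span_singleton {R : Type*} [CommRing R] (c : R) :
    e12 '' ((Ideal.span {c} : Ideal R) : Set R) = Set.range fun t : R ↦ e12 (c * t) := by
  ext g
  constructor
  · rintro ⟨x, hx, rfl⟩
    obtain ⟨a, rfl⟩ := Ideal.mem_span_singleton'.1 hx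
    exact ⟨a, by rw [mul_comm]⟩
  · rintro ⟨t, rfl⟩
    exact ⟨c * t, Ideal.mem_span_singleton'.2 ⟨t, mul_comm _ _⟩, rfl⟩

/-- `E₂₁((N)) = {E₂₁(N t)}` as a range. [cite: Morris2007, §2.1 (Notation: `LU(n, 𝔮)`)] -/
theorem image_e21_span_singleton {R : Type*} [CommRing R] (c : R) :
    e21 '' ((Ideal.span {c} : Ideal R) : Set R) = Set.range fun t : R ↦ e21 (c * t) := by
  ext g
  constructor
  · rintro ⟨x, hx, rfl⟩
    obtain ⟨a, rfl⟩ := Ideal.mem_span_singleton'.1 hx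
    exact ⟨a, by rw [mul_comm]⟩
  · rintro ⟨t, rfl⟩
    exact ⟨c * t, Ideal.mem_span_singleton'.2 ⟨t, mul_comm _ _⟩, rfl⟩

/-- **Consumer form, `Set.range` spelling** (cell bsd-f3-mu, Sketch4 `ElementaryLevelSubgroupFiniteIndex
p N` with `upperUnip`/`lowerUnip` the tree's `SL2Rel.e12`/`SL2Rel.e21`): for `m ≥ 2`, `N ≥ 1`,
`⟨E₁₂(N t), E₂₁(N t) : t ∈ ℤ[1/m]⟩` has finite index in `SL₂(ℤ[1/m])`. [cite: Morris2007, Thm. 6.1 (2)] -/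
theorem closure_range_e12_e21_finiteIndex (h : thm61_2_elementary_boundedlyGenerates) {m : ℕ}
    (hm : 2 ≤ m) {N : ℕ} (hN : N ≠ 0) :
    (Subgroup.closure
      ((Set.range fun t : Localization.Away (m : ℤ) ↦ e12 ((N : Localization.Away (m : ℤ)) * t)) ∪
        (Set.range fun t : Localization.Away (m : ℤ) ↦ e21 ((N : Localization.Away (m : ℤ)) * t)))).FiniteIndex := by
  have h1 := relE_span_natCast_finiteIndex h hm hN
  rwa [relE, image_e12_span_singleton, image_e21_span_singleton] at h1

end Morris2007

end Literature.GroupTheory.ArithmeticGroups
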